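import Mathlib
import Summits.Ventures.HodgeRepro2.T5HeckeDoubleCoset

/-!
# `π` irreducible ⇒ `π^K` is a simple `H(G, K)`-module

Blind cell `pub-hodge-repro2`, seat p8 (gen 8), Tier-5 kernel support.  The Hecke dictionary's
sentence «for an irreducible smooth `π`, the `K`-invariants `π^K` are either `0` or a simple
`H(G, K)`-module» (Bernstein–Zelevinsky; Bump Prop. 4.2.3-type statements) is recorded here with the
objects of `T5HeckePermutationModule` (T5-52: `H(G, K) = End_G(k[G ⧸ K])` acting on `V^K` by
`heckeSMul`) and `T5HeckeDoubleCoset` (T5-53: `e_K ρ(g) e_K = #(KgK/K)⁻¹ · T_g` on `V^K`), for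
Mathlib's `Representation.IsIrreducible` (no proper non-zero subrepresentation):

* `IsHeckeSubmodule ρ M` — a `k`-subspace `M ≤ V^K` stable under every `T ∈ H(G, K)`;
* `gSpan ρ M` — the subrepresentation of `V` generated by `M` (`gSpanSub`), with
  `map_gSpan_le`: `e_K` maps it back into `M` — the proof of the dictionary sentence
  (`e_K ρ(g) m = e_K ρ(g) e_K m = #(KgK/K)⁻¹ · T_g • m ∈ M`);
* `eq_bot_or_eq_top_of_isHeckeSubmodule` — THE THEOREM: for `ρ` irreducible, `ρ` `K`-finite,
  every `KgK/K` finite (e.g. `K` compact open) and characteristic `0`, every Hecke-stable subspace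
  of `V^K` is `⊥` or `⊤`;
* `isSimpleModule_heckeModule` — the same as Mathlib's `IsSimpleModule` for the module structure
  `heckeModule ρ` of T5-52 over `H(G, K)ᵐᵒᵖ`, when `V^K ≠ 0`.

What stays prose: the converse direction (π ↦ π^K is a bijection between irreducible smooth
representations with π^K ≠ 0 and simple H(G,K)-modules) and the printed theorems.

README §8(d): uses an L-value-free non-vanishing device: NO.
-/

namespace Summit.Ventures.HodgeRepro2.T5HeckeSimpleInvariants

noncomputable section

open Summit.Ventures.HodgeRepro2.LevelPositivity
open Summit.Ventures.HodgeRepro2.T5LevelIdempotent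
open Summit.Ventures.HodgeRepro2.T5LevelIdempotentDual
open Summit.Ventures.HodgeRepro2.T5HeckeOperator
open Summit.Ventures.HodgeRepro2.T5HeckePermutationModule
open Summit.Ventures.HodgeRepro2.T5HeckeDoubleCoset
open MulAction

variable {G : Type*} [Group G] {k : Type*} [Field k] {V : Type*} [AddCommGroup V] [Module k V]

variable (ρ : Representation k G V) {K : Subgroup G}

/-- A `k`-subspace `M ≤ V^K` is an `H(G, K)`-submodule when it is stable under every `T ∈ H(G, K)`. -/
def IsHeckeSubmodule (M : Submodule k (invariants ρ K)) : Prop :=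
  ∀ T : heckeAlgebra k K, ∀ m ∈ M, heckeSMul ρ T m ∈ M

/-- The subspace of `V` spanned by the `G`-translates of a subspace `M ≤ V^K`. -/
def gSpan (M : Submodule k (invariants ρ K)) : Submodule k V :=
  Submodule.span k {v | ∃ g : G, ∃ m ∈ M, ρ g (m : V) = v}

/-- `gSpan ρ M` is `G`-stable. -/
theorem apply_mem_gSpan (M : Submodule k (invariants ρ K)) (g : G) {v : V}
    (hv : v ∈ gSpan ρ M) : ρ g v ∈ gSpan ρ M := by
  have h : (gSpan ρ M).map (ρ g) ≤ gSpan ρ M := by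
    rw [gSpan, Submodule.map_span, Submodule.span_le]
    rintro _ ⟨_, ⟨h, m, hm, rfl⟩, rfl⟩
    exact Submodule.subset_span ⟨g * h, m, hm, by rw [map_mul, Module.End.mul_apply]⟩
  exact h ⟨v, hv, rfl⟩

/-- The subrepresentation of `V` generated by `M ≤ V^K`. -/
def gSpanSub (M : Submodule k (invariants ρ K)) : Subrepresentation ρ :=
  ⟨gSpan ρ M, fun g _ hv => apply_mem_gSpan ρ M g hv⟩

/-- `M` lies in its `G`-span. -/
theorem le_gSpan (M : Submodule k (invariants ρ K)) :
    M.map (invariants ρ K).subtype ≤ gSpan ρ M := by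
  rintro _ ⟨m, hm, rfl⟩
  exact Submodule.subset_span ⟨1, m, hm, by simp⟩

/-- `e_K` maps the `G`-span of a Hecke-stable `M` back into `M`: `e_K ρ(g) m = #(KgK/K)⁻¹ · T_g • m`. -/
theorem map_gSpan_le [CharZero k] (hK : KFinite ρ K)
    (hfin : ∀ g : G, Finite (orbit K (g : G ⧸ K))) {M : Submodule k (invariants ρ K)}
    (hM : IsHeckeSubmodule ρ M) : (gSpan ρ M).map (levelIdempotentTo ρ hK) ≤ M := by
  rw [gSpan, Submodule.map_span, Submodule.span_le]
  rintro _ ⟨_, ⟨g, m, hm, rfl⟩, rfl⟩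
  have h : levelIdempotentTo ρ hK (ρ g (m : V)) = heckeOp ρ hK g m := rfl
  rw [SetLike.mem_coe, h]
  haveI := hfin g
  rw [heckeOp_eq_inv_ncard_smul]
  exact M.smul_mem _ (hM _ m hm)

/-- THE THEOREM: for `ρ` irreducible (Mathlib's `Representation.IsIrreducible`), `ρ` `K`-finite,
every `KgK/K` finite and characteristic `0`, every `H(G, K)`-stable subspace of `V^K` is `⊥` or `⊤`:
`π^K` is `0` or a simple `H(G, K)`-module. -/
theorem eq_bot_or_eq_top_of_isHeckeSubmodule [CharZero k] [ρ.IsIrreducible] (hK : KFinite ρ K)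
    (hfin : ∀ g : G, Finite (orbit K (g : G ⧸ K))) {M : Submodule k (invariants ρ K)}
    (hM : IsHeckeSubmodule ρ M) : M = ⊥ ∨ M = ⊤ := by
  rcases eq_bot_or_eq_top (gSpanSub ρ M) with h | h
  · left
    have hb : gSpan ρ M = ⊥ := congrArg Subrepresentation.toSubmodule h
    rw [eq_bot_iff]
    intro m hm
    have hmem : (m : V) ∈ gSpan ρ M := le_gSpan ρ M ⟨m, hm, rfl⟩
    rw [hb, Submodule.mem_bot] at hmem
    rw [Submodule.mem_bot]
    exact Subtype.ext hmem
  · right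
    have ht : gSpan ρ M = ⊤ := congrArg Subrepresentation.toSubmodule h
    rw [eq_top_iff]
    intro v _
    have h1 : levelIdempotentTo ρ hK (v : V) = v := by
      ext
      rw [levelIdempotentTo_apply, levelAverage_of_mem_invariants v.2]
    rw [← h1]
    exact map_gSpan_le ρ hK hfin hM ⟨v, ht ▸ Submodule.mem_top, rfl⟩

/-- A submodule of `V^K` over `H(G, K)ᵐᵒᵖ` (for the module structure `heckeModule ρ`) is a
`k`-subspace: the scalars `c ∈ k` act through `c • 1 ∈ H(G, K)`. -/
def toSubmoduleK (N : @Submodule (heckeAlgebra k K)ᵐᵒᵖ (invariants ρ K) _ _ (heckeModule ρ)) :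
    Submodule k (invariants ρ K) where
  carrier := N
  add_mem' := N.add_mem
  zero_mem' := N.zero_mem
  smul_mem' c v hv := by
    have h : c • v = heckeSMul ρ (c • (1 : heckeAlgebra k K)) v := by
      rw [heckeSMul_smul_left, heckeSMul_one]
    show c • v ∈ N
    rw [h]
    letI := heckeModule (K := K) ρ
    exact N.smul_mem (MulOpposite.op (c • (1 : heckeAlgebra k K))) hv

/-- `toSubmoduleK N` is Hecke-stable. -/
theorem isHeckeSubmodule_toSubmoduleK
    (N : @Submodule (heckeAlgebra k K)ᵐᵒᵖ (invariants ρ K) _ _ (heckeModule ρ)) :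
    IsHeckeSubmodule ρ (toSubmoduleK ρ N) := fun T m hm => by
  letI := heckeModule (K := K) ρ
  exact N.smul_mem (MulOpposite.op T) hm

/-- Membership in `toSubmoduleK`. -/
theorem mem_toSubmoduleK_iff
    (N : @Submodule (heckeAlgebra k K)ᵐᵒᵖ (invariants ρ K) _ _ (heckeModule ρ))
    {v : invariants ρ K} : v ∈ toSubmoduleK ρ N ↔ v ∈ N := Iff.rfl

/-- THE THEOREM, in Mathlib's words: for `ρ` irreducible with `V^K ≠ 0`, `V^K` is a simple module
over `H(G, K)ᵐᵒᵖ` for the structure `heckeModule ρ` of T5-52. -/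
theorem isSimpleModule_heckeModule [CharZero k] [ρ.IsIrreducible] (hK : KFinite ρ K)
    (hfin : ∀ g : G, Finite (orbit K (g : G ⧸ K))) (hne : invariants ρ K ≠ ⊥) :
    @IsSimpleModule (heckeAlgebra k K)ᵐᵒᵖ _ (invariants ρ K) _ (heckeModule ρ) := by
  letI := heckeModule (K := K) ρ
  haveI : Nontrivial (invariants ρ K) := Submodule.nontrivial_iff_ne_bot.mpr hne
  refine { eq_bot_or_eq_top := fun N => ?_ }
  rcases eq_bot_or_eq_top_of_isHeckeSubmodule ρ hK hfin (isHeckeSubmodule_toSubmoduleK ρ N)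
    with h | h
  · left
    rw [eq_bot_iff]
    intro v hv
    have : v ∈ toSubmoduleK ρ N := hv
    rw [h, Submodule.mem_bot] at this
    rw [this]
    exact Submodule.zero_mem _
  · right
    rw [eq_top_iff]
    intro v _
    have : v ∈ toSubmoduleK ρ N := h ▸ Submodule.mem_top
    exact this

end

end Summit.Ventures.HodgeRepro2.T5HeckeSimpleInvariants
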